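import Mathlib
import HarnessLib
import Summits.HubbardSuperconductivity.HubbardSuperconductivity.Theorems.KLProgrammeKLRegimeEngineGeneralStepAliasArith
import Summits.HubbardSuperconductivity.HubbardSuperconductivity.Theorems.KLProgrammeKLRegimeSplitFrameDegreeGuard

/-!
# K3 gen-8-FLOW (stmt 20437, stub (C), «(C)-B-ALIAS-L», located «(C)-S-ROW-GRADING»): THE VOLUME ARITHMETIC OF THE GENERAL-STEP (B) DOOR'S
# ALIAS GROUPS at `Md = 38` with GRADED far moments — abstract pieces (cell gate-hubbard-kl, seat p2 g21)

`…GeneralStepAliasArith` (p639316, `Md = 28`) priced the alias group of the general-step (B) door in the currency `Q = S⁸U²⁰/(2^60β⁴)` and the far group in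
`Xv⁴` under UNGRADED far moments (`|β|L²·Ss ≤ Ns`, `Ss′ ≤ Ns′`).  Located «(C)-S-ROW-GRADING» (KL STATUS 2026-08-28 15:26Z): the two-leg data of the door at
scale `m` have position kernels of range `Λ_m⁻¹ = 32·4^m`, so their moments of order `k` are NATURALLY `≍ (32·4^m)^k × (order-0 mass)`; (i) with the
per-order alias moment `Nj ≍ N₀·(32·4^m)ʲ` the `Md = 28` currency `4^m·Nj²·U²⁰/β⁴ ∝ 4^{(2j+1)m}/β⁴` is NOT β-uniform at deep scales for `j ≥ 2`, and (ii) a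
β-uniform `Ns ≥ |β|L²·Ss` does not exist.  Cure, this file: (i) TEN MORE SPENT DERIVATIVES — `Md = 38`, each spent derivative worth `ρ·(2/N) ≤ U/(2^26β)`, so the
alias currency becomes `Q′ = S⁸U³⁰/(2^218β^14)` (`(38!)² ≤ 2^298`), and `4^{9m}/β^{14} ≤ β^{−5}`; (ii) GRADED far envelopes `|β|L²·Ss ≤ Ns·(4^m)^s`,
`Ss′ ≤ Ns′·(4^m)^s` with `30 ≤ s`: the far pieces keep `(4^m)²·(4/L) ≤ β²·Xv/64` (`4^m ≤ β/8`, `4/L ≤ Xv ≤ 1/β³`) instead of discarding `(4/L)^{s−10}`, and land in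
the SAME currency `Xv⁴` (`pow_absorb_sq`: `l^{2s}·q^{s−6} ≤ Xv⁴`; `pow_absorb_lin`: `l^s·q^{s−6} ≤ Xv⁴`).

* §1 `aliasTerm38_le` (`a(38!)²ρ³⁸r^{38−j−4} ≤ a(38!)²B⁸ε³⁰`), `gevreyRow38_le_of_le` (`(38!)²(2^22Eβ²)⁸(U/(2^26β))³⁰ ≤ S⁸U³⁰/(2^218β^14)` for `E ≤ 2^11S`);
* §2 `pow_absorb_sq`, `pow_absorb_lin`, `four_pow_le_beta_div_eight` (`4^m ≤ β/8`, `m ≤ n_β+1`), `xv_le_inv_cube` (`Xv ≤ 1/β³`);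
* §3 the alias pieces at `Md = 38` (same constants as at `28`): `genTreeAlias38_le` (`≤ 2^27·4^m·Nj²·Q`), `genJaAlias38_le` (`≤ 2^10·Q`), `genJbAlias38_le`
  (`≤ 2^21·Nj′·Q`) with `(38!)²B⁸ε³⁰ ≤ Q`, and their `0 ≤` twins;
* §4 the GRADED far pieces: `genTreeFar_le_graded` (`≤ 2^24·4^m·Ns²·Xv⁴` from `(P₆+P₂)·X′ ≤ 2^12·4^m·(Ns·lˢ)²`), `genJbFar_le_graded` (`≤ 2^18·Ns′·Xv⁴` from
  `Ss′ ≤ Ns′·lˢ`), for `0 ≤ l ≤ β/8`, `0 ≤ 4/L ≤ Xv ≤ 1/β³`, `30 ≤ s` (the `a` far piece has no moment: `genJaFar_le` of p639316 applies verbatim).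

Pure real arithmetic; no definitions; nothing about the model's sizes is asserted; nothing asserts superconductivity.
References: BGM 2006 §2.3 (2.21)–(2.24) [cite: BenfattoGiulianiMastropietro2006].
-/

noncomputable section

namespace Summit.HubbardSuperconductivity.HubbardSuperconductivity.Theorems.EngineV8

set_option linter.dupNamespace false -- summit = problem name (single-conjunct summit), D-0017
set_option exponentiation.threshold 1024

open Real Finset Summit.HubbardSuperconductivity.HubbardSuperconductivity.Theorems.KLRegimeSplit
open Summit.HubbardSuperconductivity.HubbardSuperconductivity.Theorems.KLProgrammeLegKernels
open scoped Nat
 -- `2^604`, `2^780` appear in the order-38 row price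

/-! ## §1 The order-38 row price -/

/-- **The `j`-uniform Gevrey-row bound at `Md = 38`**: `a·(38!)²·ρ³⁸·r^{38−j−4} ≤ a·(38!)²·B⁸·ε³⁰` for `j ≤ 4`, from `ρ·r ≤ ε`, `ρ ≤ B`, `0 ≤ r ≤ 1`.
[cite: BenfattoGiulianiMastropietro2006, §2.3 (2.24)] -/
theorem aliasTerm38_le {a ρ r ε B : ℝ} (ha : 0 ≤ a) (hρ0 : 0 ≤ ρ) (hr0 : 0 ≤ r) (hr1 : r ≤ 1) (hρr : ρ * r ≤ ε) (hρB : ρ ≤ B)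
    {j : ℕ} (hj : j ≤ 4) :
    a * ((38 ! : ℝ)) ^ 2 * ρ ^ 38 * r ^ (38 - j - 4) ≤ a * ((38 ! : ℝ)) ^ 2 * B ^ 8 * ε ^ 30 := by
  have h1 : r ^ (38 - j - 4) ≤ r ^ 30 := pow_le_pow_of_le_one hr0 hr1 (by omega)
  have h3 : ρ ^ 8 ≤ B ^ 8 := pow_le_pow_left₀ hρ0 hρB 8
  have h4 : (ρ * r) ^ 30 ≤ ε ^ 30 := pow_le_pow_left₀ (mul_nonneg hρ0 hr0) hρr 30
  have ha2 : 0 ≤ a * ((38 ! : ℝ)) ^ 2 := by positivity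
  calc a * ((38 ! : ℝ)) ^ 2 * ρ ^ 38 * r ^ (38 - j - 4) ≤ a * ((38 ! : ℝ)) ^ 2 * ρ ^ 38 * r ^ 30 :=
        mul_le_mul_of_nonneg_left h1 (by positivity)
    _ = a * ((38 ! : ℝ)) ^ 2 * (ρ ^ 8 * (ρ * r) ^ 30) := by ring
    _ ≤ a * ((38 ! : ℝ)) ^ 2 * (B ^ 8 * ε ^ 30) :=
        mul_le_mul_of_nonneg_left (mul_le_mul h3 h4 (by positivity) ((pow_nonneg hρ0 8).trans h3)) ha2
    _ = a * ((38 ! : ℝ)) ^ 2 * B ^ 8 * ε ^ 30 := by ring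

/-- **THE ORDER-38 ROW PRICE**: `E ≤ 2^11·S`, `0 ≤ E`: `(38!)²·(2^22Eβ²)⁸·(U/(2^26β))³⁰ ≤ S⁸·U³⁰/(2^218·β^14)` (`(38!)² ≤ 2^298`, `klBetaMin ≤ β`).
[cite: BenfattoGiulianiMastropietro2006, §2.3 (2.24)] -/
theorem gevreyRow38_le_of_le {β U E S : ℝ} (hβ : klBetaMin ≤ β) (hE0 : 0 ≤ E) (hE : E ≤ 2 ^ 11 * S) :
    ((38 ! : ℝ)) ^ 2 * (2 ^ 22 * E * β ^ 2) ^ 8 * (U / (2 ^ 26 * β)) ^ 30 ≤ S ^ 8 * U ^ 30 / (2 ^ 218 * β ^ 14) := by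
  have h128 : (128 : ℝ) ≤ β := by simpa [klBetaMin] using hβ
  have hβ0 : (0 : ℝ) < β := by linarith
  have hfac : ((38 ! : ℝ)) ^ 2 ≤ 2 ^ 298 := by norm_num [Nat.factorial]
  have hE8 : E ^ 8 ≤ (2 ^ 11 * S) ^ 8 := pow_le_pow_left₀ hE0 hE 8
  have hU30 : 0 ≤ U ^ 30 := by positivity
  have heq : ((38 ! : ℝ)) ^ 2 * (2 ^ 22 * E * β ^ 2) ^ 8 * (U / (2 ^ 26 * β)) ^ 30 =
      (((38 ! : ℝ)) ^ 2 * E ^ 8 / (2 ^ 302 * 2 ^ 302)) * (U ^ 30 / β ^ 14) := by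
    rw [div_pow, mul_pow, mul_pow]
    field_simp
  have heq2 : S ^ 8 * U ^ 30 / (2 ^ 218 * β ^ 14) = (S ^ 8 / 2 ^ 218) * (U ^ 30 / β ^ 14) := by
    rw [mul_comm (2 ^ 218 : ℝ) (β ^ 14), ← div_div, mul_div_assoc, div_mul_eq_mul_div, mul_div_assoc]
  rw [heq, heq2]
  refine mul_le_mul_of_nonneg_right ?_ (by positivity)
  rw [div_le_div_iff₀ (by positivity) (by positivity)]
  calc ((38 ! : ℝ)) ^ 2 * E ^ 8 * 2 ^ 218 ≤ 2 ^ 298 * (2 ^ 11 * S) ^ 8 * 2 ^ 218 := by gcongr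
    _ = S ^ 8 * (2 ^ 302 * 2 ^ 302) := by ring

/-! ## §2 Absorption of the graded far weights into `Xv⁴` -/

/-- **`l^{2s}·q^{s−6} ≤ Xv⁴`** for `0 ≤ l ≤ β/8`, `0 ≤ q ≤ Xv ≤ 1/β³`, `30 ≤ s` (`(l²q)^{s−6}·l^{12}`, `l²q ≤ β²Xv/64`, `β²Xv ≤ 1/β`).
[cite: BenfattoGiulianiMastropietro2006, §2.3 (2.24)] -/
theorem pow_absorb_sq {l q Xv β : ℝ} {s : ℕ} (hl0 : 0 ≤ l) (hl : l ≤ β / 8) (hq0 : 0 ≤ q) (hq : q ≤ Xv) (hXv : Xv ≤ 1 / β ^ 3)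
    (hβ : 1 ≤ β) (hs : 30 ≤ s) : l ^ (2 * s) * q ^ (s - 6) ≤ Xv ^ 4 := by
  have hβ0 : 0 < β := by linarith
  have hXv0 : 0 ≤ Xv := hq0.trans hq
  obtain ⟨t, rfl⟩ : ∃ t, s = 30 + t := ⟨s - 30, by omega⟩
  -- split the exponents
  have e1 : l ^ (2 * (30 + t)) = l ^ 12 * (l ^ 2) ^ (24 + t) := by
    rw [← pow_mul, ← pow_add]; congr 1; omega
  have e2 : q ^ (30 + t - 6) = q ^ 4 * q ^ (20 + t) := by
    rw [← pow_add]; congr 1; omega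
  rw [e1, e2]
  -- `(l²)^{24+t}·q^{20+t} = (l²q)^{20+t}·(l²)^4`
  have e3 : l ^ 12 * (l ^ 2) ^ (24 + t) * (q ^ 4 * q ^ (20 + t)) = (l ^ 20 * q ^ 4) * (l ^ 2 * q) ^ (20 + t) := by
    rw [mul_pow]; ring
  rw [e3]
  -- the small factor `(l²q)^{20+t} ≤ (l²q)^{20} ≤ (β²Xv/64)^{20} ≤ (1/(64β))^{20}`
  have hl2q : l ^ 2 * q ≤ 1 / (64 * β) := by
    have h1 : l ^ 2 ≤ (β / 8) ^ 2 := pow_le_pow_left₀ hl0 hl 2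
    have h2 : l ^ 2 * q ≤ (β / 8) ^ 2 * (1 / β ^ 3) := mul_le_mul h1 (hq.trans hXv) hq0 (by positivity)
    have h3 : (β / 8) ^ 2 * (1 / β ^ 3) = 1 / (64 * β) := by field_simp; ring
    linarith [h3]
  have hl2q0 : 0 ≤ l ^ 2 * q := by positivity
  have hl2q1 : l ^ 2 * q ≤ 1 := hl2q.trans (by rw [div_le_one (by positivity)]; linarith)
  have hsmall : (l ^ 2 * q) ^ (20 + t) ≤ (1 / (64 * β)) ^ 20 :=
    (pow_le_pow_of_le_one hl2q0 hl2q1 (by omega)).trans (pow_le_pow_left₀ hl2q0 hl2q 20)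
  -- the large factor `l^{20}·q⁴ ≤ (β/8)^{20}·Xv⁴`
  have hbig : l ^ 20 * q ^ 4 ≤ (β / 8) ^ 20 * Xv ^ 4 := mul_le_mul (pow_le_pow_left₀ hl0 hl 20) (pow_le_pow_left₀ hq0 hq 4) (by positivity) (by positivity)
  have hprod : (β / 8) ^ 20 * (1 / (64 * β)) ^ 20 = 1 / 2 ^ 180 := by
    rw [← mul_pow]; rw [show β / 8 * (1 / (64 * β)) = 1 / 512 by field_simp; ring]; norm_num
  calc (l ^ 20 * q ^ 4) * (l ^ 2 * q) ^ (20 + t) ≤ ((β / 8) ^ 20 * Xv ^ 4) * (1 / (64 * β)) ^ 20 :=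
        mul_le_mul hbig hsmall (by positivity) (by positivity)
    _ = ((β / 8) ^ 20 * (1 / (64 * β)) ^ 20) * Xv ^ 4 := by ring
    _ = 1 / 2 ^ 180 * Xv ^ 4 := by rw [hprod]
    _ ≤ Xv ^ 4 := by
        have : 0 ≤ Xv ^ 4 := by positivity
        nlinarith

/-- **`l^s·q^{s−6} ≤ Xv⁴`** for `0 ≤ l ≤ β/8`, `0 ≤ q ≤ Xv ≤ 1/β³`, `30 ≤ s` (`(lq)^{s−6}·l⁶`, `lq ≤ 1/(8β²)`).
[cite: BenfattoGiulianiMastropietro2006, §2.3 (2.24)] -/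
theorem pow_absorb_lin {l q Xv β : ℝ} {s : ℕ} (hl0 : 0 ≤ l) (hl : l ≤ β / 8) (hq0 : 0 ≤ q) (hq : q ≤ Xv) (hXv : Xv ≤ 1 / β ^ 3)
    (hβ : 1 ≤ β) (hs : 30 ≤ s) : l ^ s * q ^ (s - 6) ≤ Xv ^ 4 := by
  have hβ0 : 0 < β := by linarith
  have hXv0 : 0 ≤ Xv := hq0.trans hq
  obtain ⟨t, rfl⟩ : ∃ t, s = 30 + t := ⟨s - 30, by omega⟩
  have e1 : l ^ (30 + t) = l ^ 10 * l ^ (20 + t) := by rw [← pow_add]; congr 1; omega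
  have e2 : q ^ (30 + t - 6) = q ^ 4 * q ^ (20 + t) := by rw [← pow_add]; congr 1; omega
  rw [e1, e2]
  have e3 : l ^ 10 * l ^ (20 + t) * (q ^ 4 * q ^ (20 + t)) = (l ^ 10 * q ^ 4) * (l * q) ^ (20 + t) := by rw [mul_pow]; ring
  rw [e3]
  have hlq : l * q ≤ 1 / (8 * β ^ 2) := by
    have h2 : l * q ≤ (β / 8) * (1 / β ^ 3) := mul_le_mul hl (hq.trans hXv) hq0 (by positivity)
    have h3 : (β / 8) * (1 / β ^ 3) = 1 / (8 * β ^ 2) := by field_simp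
    linarith [h3]
  have hlq0 : 0 ≤ l * q := by positivity
  have hlq1 : l * q ≤ 1 := hlq.trans (by rw [div_le_one (by positivity)]; nlinarith)
  have hsmall : (l * q) ^ (20 + t) ≤ (1 / (8 * β ^ 2)) ^ 5 :=
    (pow_le_pow_of_le_one hlq0 hlq1 (by omega)).trans (pow_le_pow_left₀ hlq0 hlq 5)
  have hbig : l ^ 10 * q ^ 4 ≤ (β / 8) ^ 10 * Xv ^ 4 := mul_le_mul (pow_le_pow_left₀ hl0 hl 10) (pow_le_pow_left₀ hq0 hq 4) (by positivity) (by positivity)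
  have hprod : (β / 8) ^ 10 * (1 / (8 * β ^ 2)) ^ 5 = 1 / 2 ^ 45 := by
    have : (β / 8) ^ 10 * (1 / (8 * β ^ 2)) ^ 5 = ((β / 8) ^ 2 * (1 / (8 * β ^ 2))) ^ 5 := by rw [mul_pow, ← pow_mul]
    rw [this, show (β / 8) ^ 2 * (1 / (8 * β ^ 2)) = 1 / 512 by field_simp; ring]; norm_num
  calc (l ^ 10 * q ^ 4) * (l * q) ^ (20 + t) ≤ ((β / 8) ^ 10 * Xv ^ 4) * (1 / (8 * β ^ 2)) ^ 5 :=
        mul_le_mul hbig hsmall (by positivity) (by positivity)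
    _ = ((β / 8) ^ 10 * (1 / (8 * β ^ 2)) ^ 5) * Xv ^ 4 := by ring
    _ = 1 / 2 ^ 45 * Xv ^ 4 := by rw [hprod]
    _ ≤ Xv ^ 4 := by
        have : 0 ≤ Xv ^ 4 := by positivity
        nlinarith

/-- **`4^m ≤ β/8`** for `m ≤ n_β + 1`, `klBetaMin ≤ β` (`4^{n_β} ≤ β/(32π)`). [cite: BenfattoGiulianiMastropietro2006, §2.3 (2.21)] -/
theorem four_pow_le_beta_div_eight {β : ℝ} (hβ : klBetaMin ≤ β) {m : ℕ} (hm : m ≤ nScales β + 1) : (4 : ℝ) ^ m ≤ β / 8 := by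
  have h128 : (128 : ℝ) ≤ β := by simpa [klBetaMin] using hβ
  have h1 : (4 : ℝ) ^ m ≤ (4 : ℝ) ^ (nScales β + 1) := pow_le_pow_right₀ (by norm_num) hm
  have h2 := four_pow_nScales_le hβ
  rw [pow_succ] at h1
  rw [klE0] at h2
  have h4 : 1 / 32 * β / Real.pi ≤ β / 32 := by
    rw [div_le_div_iff₀ Real.pi_pos (by norm_num : (0:ℝ) < 32)]
    nlinarith [Real.pi_gt_three, h128]
  have h3 : (4 : ℝ) ^ nScales β * 4 ≤ β / 8 := by
    rw [le_div_iff₀ (by norm_num : (0:ℝ) < 8)]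
    nlinarith
  exact h1.trans h3

/-- **`Xv ≤ 1/β³`**: `U/(2^59·klEngPsq P²·klEngRsq R²·β³) ≤ 1/β³` for `U ≤ 1`, `0 < β`. [cite: BenfattoGiulianiMastropietro2006, §2.3 (2.21)] -/
theorem xv_le_inv_cube (P : SplitConsts) (R : RenConsts) {U β : ℝ} (hU1 : U ≤ 1) (hβ0 : 0 < β) :
    U / (2 ^ 59 * klEngPsq P ^ 2 * klEngRsq R ^ 2 * β ^ 3) ≤ 1 / β ^ 3 := by
  have hPR : 1 ≤ klEngPsq P ^ 2 * klEngRsq R ^ 2 :=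
    one_le_mul_of_one_le_of_one_le (one_le_pow₀ (one_le_klEngPsq P)) (one_le_pow₀ (one_le_klEngRsq R))
  have hP0 := klEngPsq_pos P
  have hR0 := klEngRsq_pos R
  rw [div_le_div_iff₀ (by positivity) (by positivity), one_mul]
  calc U * β ^ 3 ≤ 1 * β ^ 3 := by gcongr
    _ ≤ (2 ^ 59 * (klEngPsq P ^ 2 * klEngRsq R ^ 2)) * β ^ 3 := by gcongr; nlinarith
    _ = 2 ^ 59 * klEngPsq P ^ 2 * klEngRsq R ^ 2 * β ^ 3 := by ring

/-! ## §3 The alias pieces at `Md = 38` -/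

/-- **Tree alias piece, `Md = 38`**: `2(2(X·(3ʲ·(P₆(38!)²ρ₁³⁸ + P₂(38!)²ρ₂³⁸)·r^{38−j−4}·S))) ≤ 2^27·4^m·Nj²·Q`, from `X·(P₆+P₂) ≤ 2^12·4^m·Nj²`, the ratio laws and
`(38!)²B⁸ε³⁰ ≤ Q`. [cite: BenfattoGiulianiMastropietro2006, §2.3 (2.24)] -/
theorem genTreeAlias38_le {X P6 P2 ρ₁ ρ₂ r S ε B Q Nj : ℝ} {m j : ℕ} (hj : j ≤ 4) (hX0 : 0 ≤ X) (hP6 : 0 ≤ P6) (hP2 : 0 ≤ P2)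
    (hXP : X * (P6 + P2) ≤ 2 ^ 12 * (4 : ℝ) ^ m * Nj ^ 2) (hρ10 : 0 ≤ ρ₁) (hρ20 : 0 ≤ ρ₂) (hr0 : 0 ≤ r) (hr1 : r ≤ 1)
    (hρ1r : ρ₁ * r ≤ ε) (hρ1B : ρ₁ ≤ B) (hρ2r : ρ₂ * r ≤ ε) (hρ2B : ρ₂ ≤ B) (hS0 : 0 ≤ S) (hS : S ≤ 81)
    (hQ : ((38 ! : ℝ)) ^ 2 * B ^ 8 * ε ^ 30 ≤ Q) :
    2 * (2 * (X * ((3 : ℝ) ^ j * (P6 * ((38 ! : ℝ)) ^ 2 * ρ₁ ^ 38 + P2 * ((38 ! : ℝ)) ^ 2 * ρ₂ ^ 38) * r ^ (38 - j - 4) * S))) ≤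
      2 ^ 27 * (4 : ℝ) ^ m * Nj ^ 2 * Q := by
  have h3 : (3 : ℝ) ^ j ≤ 81 := by
    calc (3 : ℝ) ^ j ≤ 3 ^ 4 := pow_le_pow_right₀ (by norm_num) hj
      _ = 81 := by norm_num
  have hB0 : 0 ≤ B := hρ10.trans hρ1B
  have hε0 : 0 ≤ ε := (mul_nonneg hρ10 hr0).trans hρ1r
  have hT1 := aliasTerm38_le hP6 hρ10 hr0 hr1 hρ1r hρ1B hj
  have hT2 := aliasTerm38_le hP2 hρ20 hr0 hr1 hρ2r hρ2B hj
  have hQ0 : 0 ≤ ((38 ! : ℝ)) ^ 2 * B ^ 8 * ε ^ 30 := by positivity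
  have hD : (P6 * ((38 ! : ℝ)) ^ 2 * ρ₁ ^ 38 + P2 * ((38 ! : ℝ)) ^ 2 * ρ₂ ^ 38) * r ^ (38 - j - 4) ≤ (P6 + P2) * Q := by
    calc (P6 * ((38 ! : ℝ)) ^ 2 * ρ₁ ^ 38 + P2 * ((38 ! : ℝ)) ^ 2 * ρ₂ ^ 38) * r ^ (38 - j - 4)
        = P6 * ((38 ! : ℝ)) ^ 2 * ρ₁ ^ 38 * r ^ (38 - j - 4) + P2 * ((38 ! : ℝ)) ^ 2 * ρ₂ ^ 38 * r ^ (38 - j - 4) := by ring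
      _ ≤ P6 * ((38 ! : ℝ)) ^ 2 * B ^ 8 * ε ^ 30 + P2 * ((38 ! : ℝ)) ^ 2 * B ^ 8 * ε ^ 30 := add_le_add hT1 hT2
      _ = (P6 + P2) * (((38 ! : ℝ)) ^ 2 * B ^ 8 * ε ^ 30) := by ring
      _ ≤ (P6 + P2) * Q := mul_le_mul_of_nonneg_left hQ (add_nonneg hP6 hP2)
  have hD0 : 0 ≤ (P6 * ((38 ! : ℝ)) ^ 2 * ρ₁ ^ 38 + P2 * ((38 ! : ℝ)) ^ 2 * ρ₂ ^ 38) * r ^ (38 - j - 4) := by positivity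
  have hQ' : 0 ≤ Q := hQ0.trans hQ
  have h81 : (3 : ℝ) ^ j * S ≤ 81 * 81 := mul_le_mul h3 hS hS0 (by norm_num)
  have hm := mul_le_mul h81 hD hD0 (by norm_num)
  have hm0 : 0 ≤ ((3 : ℝ) ^ j * S) * ((P6 * ((38 ! : ℝ)) ^ 2 * ρ₁ ^ 38 + P2 * ((38 ! : ℝ)) ^ 2 * ρ₂ ^ 38) * r ^ (38 - j - 4)) := by positivity
  have hXm := mul_le_mul_of_nonneg_left hm hX0
  calc 2 * (2 * (X * ((3 : ℝ) ^ j * (P6 * ((38 ! : ℝ)) ^ 2 * ρ₁ ^ 38 + P2 * ((38 ! : ℝ)) ^ 2 * ρ₂ ^ 38) * r ^ (38 - j - 4) * S)))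
      = 4 * (X * (((3 : ℝ) ^ j * S) * ((P6 * ((38 ! : ℝ)) ^ 2 * ρ₁ ^ 38 + P2 * ((38 ! : ℝ)) ^ 2 * ρ₂ ^ 38) * r ^ (38 - j - 4)))) := by ring
    _ ≤ 4 * (X * ((81 * 81) * ((P6 + P2) * Q))) := by linarith
    _ = 26244 * ((X * (P6 + P2)) * Q) := by ring
    _ ≤ 26244 * ((2 ^ 12 * (4 : ℝ) ^ m * Nj ^ 2) * Q) := by
        have := mul_le_mul_of_nonneg_right hXP hQ'
        linarith
    _ ≤ 2 ^ 27 * (4 : ℝ) ^ m * Nj ^ 2 * Q := by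
        have : 0 ≤ (4 : ℝ) ^ m * Nj ^ 2 * Q := by positivity
        nlinarith

/-- `0 ≤` the tree alias piece (`Md = 38`). -/
theorem genTreeAlias38_nonneg {X P6 P2 ρ₁ ρ₂ r S : ℝ} (j : ℕ) (hX0 : 0 ≤ X) (hP6 : 0 ≤ P6) (hP2 : 0 ≤ P2) (hr0 : 0 ≤ r) (hS0 : 0 ≤ S) :
    0 ≤ 2 * (2 * (X * ((3 : ℝ) ^ j * (P6 * ((38 ! : ℝ)) ^ 2 * ρ₁ ^ 38 + P2 * ((38 ! : ℝ)) ^ 2 * ρ₂ ^ 38) * r ^ (38 - j - 4) * S))) := by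
  positivity

/-- **Dressing `a` alias piece, `Md = 38`**: `≤ 2^10·Q`. [cite: BenfattoGiulianiMastropietro2006, §2.3 (2.24)] -/
theorem genJaAlias38_le {Pa ρ r S ε B Q : ℝ} {j : ℕ} (hj : j ≤ 4) (hPa0 : 0 ≤ Pa) (hPa : Pa ≤ 3 / 32) (hρ0 : 0 ≤ ρ) (hr0 : 0 ≤ r) (hr1 : r ≤ 1)
    (hρr : ρ * r ≤ ε) (hρB : ρ ≤ B) (hS0 : 0 ≤ S) (hS : S ≤ 81) (hQ : ((38 ! : ℝ)) ^ 2 * B ^ 8 * ε ^ 30 ≤ Q) :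
    2 * (2 * ((1 / 4 : ℝ) * ((3 : ℝ) ^ j * (Pa * ((38 ! : ℝ)) ^ 2 * ρ ^ 38) * r ^ (38 - j - 4) * S))) ≤ 2 ^ 10 * Q := by
  have h3 : (3 : ℝ) ^ j ≤ 81 := by
    calc (3 : ℝ) ^ j ≤ 3 ^ 4 := pow_le_pow_right₀ (by norm_num) hj
      _ = 81 := by norm_num
  have hB0 : 0 ≤ B := hρ0.trans hρB
  have hε0 : 0 ≤ ε := (mul_nonneg hρ0 hr0).trans hρr
  have hT := aliasTerm38_le hPa0 hρ0 hr0 hr1 hρr hρB hj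
  have hQ0 : 0 ≤ ((38 ! : ℝ)) ^ 2 * B ^ 8 * ε ^ 30 := by positivity
  have hPQ : Pa * ((38 ! : ℝ)) ^ 2 * B ^ 8 * ε ^ 30 ≤ 3 / 32 * Q := by
    calc Pa * ((38 ! : ℝ)) ^ 2 * B ^ 8 * ε ^ 30 = Pa * (((38 ! : ℝ)) ^ 2 * B ^ 8 * ε ^ 30) := by ring
      _ ≤ 3 / 32 * Q := mul_le_mul hPa hQ hQ0 (by norm_num)
  have hX0 : 0 ≤ Pa * ((38 ! : ℝ)) ^ 2 * ρ ^ 38 * r ^ (38 - j - 4) := by positivity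
  have h81 : (3 : ℝ) ^ j * S ≤ 81 * 81 := mul_le_mul h3 hS hS0 (by norm_num)
  have hm := mul_le_mul h81 (hT.trans hPQ) hX0 (by norm_num)
  have hQ' : 0 ≤ Q := by nlinarith
  calc 2 * (2 * ((1 / 4 : ℝ) * ((3 : ℝ) ^ j * (Pa * ((38 ! : ℝ)) ^ 2 * ρ ^ 38) * r ^ (38 - j - 4) * S)))
      = ((3 : ℝ) ^ j * S) * (Pa * ((38 ! : ℝ)) ^ 2 * ρ ^ 38 * r ^ (38 - j - 4)) := by ring
    _ ≤ (81 * 81) * (3 / 32 * Q) := hm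
    _ ≤ 2 ^ 10 * Q := by nlinarith

/-- `0 ≤` the dressing `a` alias piece (`Md = 38`). -/
theorem genJaAlias38_nonneg {Pa ρ r S : ℝ} (j : ℕ) (hPa0 : 0 ≤ Pa) (hr0 : 0 ≤ r) (hS0 : 0 ≤ S) :
    0 ≤ 2 * (2 * ((1 / 4 : ℝ) * ((3 : ℝ) ^ j * (Pa * ((38 ! : ℝ)) ^ 2 * ρ ^ 38) * r ^ (38 - j - 4) * S))) := by
  positivity

/-- **Dressing `b` alias piece, `Md = 38`**: `≤ 2^21·Nj′·Q`. [cite: BenfattoGiulianiMastropietro2006, §2.3 (2.24)] -/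
theorem genJbAlias38_le {P ρ₃ ρ₄ r S ε B Q Sj' Nj' : ℝ} {j : ℕ} (hj : j ≤ 4) (hP0 : 0 ≤ P) (hP : P ≤ 12) (hρ30 : 0 ≤ ρ₃) (hρ40 : 0 ≤ ρ₄)
    (hr0 : 0 ≤ r) (hr1 : r ≤ 1) (hρ3r : ρ₃ * r ≤ ε) (hρ3B : ρ₃ ≤ B) (hρ4r : ρ₄ * r ≤ ε) (hρ4B : ρ₄ ≤ B) (hS0 : 0 ≤ S) (hS : S ≤ 81)
    (hQ : ((38 ! : ℝ)) ^ 2 * B ^ 8 * ε ^ 30 ≤ Q) (hSj0 : 0 ≤ Sj') (hSj : Sj' ≤ Nj') :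
    2 * (2 * ((1 / 4 * Sj') * ((3 : ℝ) ^ j * (P * P * ((38 ! : ℝ)) ^ 2 * ρ₄ ^ 38 + 2 * (P * ((38 ! : ℝ)) ^ 2 * ρ₃ ^ 38)) * r ^ (38 - j - 4) * S))) ≤
      2 ^ 21 * Nj' * Q := by
  have h3 : (3 : ℝ) ^ j ≤ 81 := by
    calc (3 : ℝ) ^ j ≤ 3 ^ 4 := pow_le_pow_right₀ (by norm_num) hj
      _ = 81 := by norm_num
  have hB0 : 0 ≤ B := hρ30.trans hρ3B
  have hε0 : 0 ≤ ε := (mul_nonneg hρ30 hr0).trans hρ3r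
  have hT4 := aliasTerm38_le (mul_nonneg hP0 hP0) hρ40 hr0 hr1 hρ4r hρ4B hj
  have hT3 := aliasTerm38_le hP0 hρ30 hr0 hr1 hρ3r hρ3B hj
  have hQ0 : 0 ≤ ((38 ! : ℝ)) ^ 2 * B ^ 8 * ε ^ 30 := by positivity
  have hPP : P * P + 2 * P ≤ 168 := by nlinarith
  have hD : (P * P * ((38 ! : ℝ)) ^ 2 * ρ₄ ^ 38 + 2 * (P * ((38 ! : ℝ)) ^ 2 * ρ₃ ^ 38)) * r ^ (38 - j - 4) ≤ 168 * Q := by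
    calc (P * P * ((38 ! : ℝ)) ^ 2 * ρ₄ ^ 38 + 2 * (P * ((38 ! : ℝ)) ^ 2 * ρ₃ ^ 38)) * r ^ (38 - j - 4)
        = P * P * ((38 ! : ℝ)) ^ 2 * ρ₄ ^ 38 * r ^ (38 - j - 4) + 2 * (P * ((38 ! : ℝ)) ^ 2 * ρ₃ ^ 38 * r ^ (38 - j - 4)) := by ring
      _ ≤ P * P * ((38 ! : ℝ)) ^ 2 * B ^ 8 * ε ^ 30 + 2 * (P * ((38 ! : ℝ)) ^ 2 * B ^ 8 * ε ^ 30) := by linarith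
      _ = (P * P + 2 * P) * (((38 ! : ℝ)) ^ 2 * B ^ 8 * ε ^ 30) := by ring
      _ ≤ 168 * Q := mul_le_mul hPP hQ hQ0 (by norm_num)
  have hD0 : 0 ≤ (P * P * ((38 ! : ℝ)) ^ 2 * ρ₄ ^ 38 + 2 * (P * ((38 ! : ℝ)) ^ 2 * ρ₃ ^ 38)) * r ^ (38 - j - 4) := by positivity
  have hQ' : 0 ≤ Q := by nlinarith
  have h81 : (3 : ℝ) ^ j * S ≤ 81 * 81 := mul_le_mul h3 hS hS0 (by norm_num)
  have hm := mul_le_mul h81 hD hD0 (by norm_num)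
  have hm0 : 0 ≤ ((3 : ℝ) ^ j * S) * ((P * P * ((38 ! : ℝ)) ^ 2 * ρ₄ ^ 38 + 2 * (P * ((38 ! : ℝ)) ^ 2 * ρ₃ ^ 38)) * r ^ (38 - j - 4)) := by positivity
  have hN0 : 0 ≤ Nj' := hSj0.trans hSj
  calc 2 * (2 * ((1 / 4 * Sj') * ((3 : ℝ) ^ j * (P * P * ((38 ! : ℝ)) ^ 2 * ρ₄ ^ 38 + 2 * (P * ((38 ! : ℝ)) ^ 2 * ρ₃ ^ 38)) * r ^ (38 - j - 4) * S)))
      = Sj' * (((3 : ℝ) ^ j * S) * ((P * P * ((38 ! : ℝ)) ^ 2 * ρ₄ ^ 38 + 2 * (P * ((38 ! : ℝ)) ^ 2 * ρ₃ ^ 38)) * r ^ (38 - j - 4))) := by ring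
    _ ≤ Nj' * ((81 * 81) * (168 * Q)) := mul_le_mul hSj hm hm0 hN0
    _ ≤ 2 ^ 21 * Nj' * Q := by nlinarith [mul_nonneg hN0 hQ']

/-- `0 ≤` the dressing `b` alias piece (`Md = 38`). -/
theorem genJbAlias38_nonneg {P ρ₃ ρ₄ r S Sj' : ℝ} (j : ℕ) (hP0 : 0 ≤ P) (hr0 : 0 ≤ r) (hS0 : 0 ≤ S) (hSj0 : 0 ≤ Sj') :
    0 ≤ 2 * (2 * ((1 / 4 * Sj') * ((3 : ℝ) ^ j * (P * P * ((38 ! : ℝ)) ^ 2 * ρ₄ ^ 38 + 2 * (P * ((38 ! : ℝ)) ^ 2 * ρ₃ ^ 38)) * r ^ (38 - j - 4) * S))) := by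
  positivity

/-! ## §4 The GRADED far pieces -/

/-- **Tree far piece, GRADED**: `L²Lʲ·((P₆(0!)²ρ₁⁰ + P₂(0!)²ρ₂⁰)·(X′/(1+L/4)^s)) ≤ 2^24·4^m·Ns²·Xv⁴` from `(P₆+P₂)·X′ ≤ 2^12·4^m·(Ns·lˢ)²`, `0 ≤ l ≤ β/8`,
`0 ≤ 4/L ≤ Xv ≤ 1/β³`, `30 ≤ s`, `4 ≤ L`. [cite: BenfattoGiulianiMastropietro2006, §2.3 (2.24)] -/
theorem genTreeFar_le_graded {L : ℕ} (hL4 : 4 ≤ L) {P6 P2 ρ₁ ρ₂ X' Xv Ns l β : ℝ} {m j s : ℕ} (hj : j ≤ 4) (hs : 30 ≤ s) (hP6 : 0 ≤ P6) (hP2 : 0 ≤ P2)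
    (hX'0 : 0 ≤ X') (hl0 : 0 ≤ l) (hl : l ≤ β / 8) (hβ : 1 ≤ β) (hPX : (P6 + P2) * X' ≤ 2 ^ 12 * (4 : ℝ) ^ m * (Ns * l ^ s) ^ 2)
    (h4L : 4 / (L : ℝ) ≤ Xv) (hXv : Xv ≤ 1 / β ^ 3) :
    (L : ℝ) ^ 2 * (L : ℝ) ^ j * ((P6 * ((0 ! : ℝ)) ^ 2 * ρ₁ ^ 0 + P2 * ((0 ! : ℝ)) ^ 2 * ρ₂ ^ 0) * (X' / (1 + (L : ℝ) / 4) ^ s)) ≤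
      2 ^ 24 * (4 : ℝ) ^ m * Ns ^ 2 * Xv ^ 4 := by
  have hLr : (4 : ℝ) ≤ L := by exact_mod_cast hL4
  have hLpos : (0 : ℝ) < L := by linarith
  have hq0 : 0 ≤ 4 / (L : ℝ) := by positivity
  have hA : P6 * ((0 ! : ℝ)) ^ 2 * ρ₁ ^ 0 + P2 * ((0 ! : ℝ)) ^ 2 * ρ₂ ^ 0 = P6 + P2 := by simp [Nat.factorial]
  rw [hA]
  have h := far_weight_le hL4 (add_nonneg hP6 hP2) hX'0 hj (show 6 ≤ s by omega)
  have habs : l ^ (2 * s) * (4 / (L : ℝ)) ^ (s - 6) ≤ Xv ^ 4 := pow_absorb_sq hl0 hl hq0 h4L hXv hβ hs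
  have hkey : X' * (P6 + P2) * (4 / (L : ℝ)) ^ (s - 6) ≤ 2 ^ 12 * (4 : ℝ) ^ m * Ns ^ 2 * Xv ^ 4 := by
    have e : (Ns * l ^ s) ^ 2 = Ns ^ 2 * l ^ (2 * s) := by rw [mul_pow, ← pow_mul, mul_comm s 2]
    calc X' * (P6 + P2) * (4 / (L : ℝ)) ^ (s - 6) = ((P6 + P2) * X') * (4 / (L : ℝ)) ^ (s - 6) := by ring
      _ ≤ (2 ^ 12 * (4 : ℝ) ^ m * (Ns * l ^ s) ^ 2) * (4 / (L : ℝ)) ^ (s - 6) := mul_le_mul_of_nonneg_right hPX (pow_nonneg hq0 _)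
      _ = 2 ^ 12 * (4 : ℝ) ^ m * Ns ^ 2 * (l ^ (2 * s) * (4 / (L : ℝ)) ^ (s - 6)) := by rw [e]; ring
      _ ≤ 2 ^ 12 * (4 : ℝ) ^ m * Ns ^ 2 * Xv ^ 4 := mul_le_mul_of_nonneg_left habs (by positivity)
  calc (L : ℝ) ^ 2 * (L : ℝ) ^ j * ((P6 + P2) * (X' / (1 + (L : ℝ) / 4) ^ s)) ≤ (P6 + P2) * X' * 4 ^ 6 * (4 / (L : ℝ)) ^ (s - 6) := h
    _ = 4 ^ 6 * (X' * (P6 + P2) * (4 / (L : ℝ)) ^ (s - 6)) := by ring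
    _ ≤ 4 ^ 6 * (2 ^ 12 * (4 : ℝ) ^ m * Ns ^ 2 * Xv ^ 4) := mul_le_mul_of_nonneg_left hkey (by norm_num)
    _ = 2 ^ 24 * (4 : ℝ) ^ m * Ns ^ 2 * Xv ^ 4 := by ring

/-- **Dressing `b` far piece, GRADED**: `≤ 2^18·Ns′·Xv⁴` from `Ss′ ≤ Ns′·lˢ`, `1 ≤ l ≤ β/8`, `4/L ≤ Xv ≤ 1/β³`, `30 ≤ s`, `4 ≤ L`.
[cite: BenfattoGiulianiMastropietro2006, §2.3 (2.24)] -/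
theorem genJbFar_le_graded {L : ℕ} (hL4 : 4 ≤ L) {P ρ₃ ρ₄ Xv Ss' Ns' l β : ℝ} {j s : ℕ} (hP0 : 0 ≤ P) (hP : P ≤ 12) (hSs0 : 0 ≤ Ss')
    (hj : j ≤ 4) (hs : 30 ≤ s) (hl1 : 1 ≤ l) (hl : l ≤ β / 8) (hβ : 1 ≤ β) (hSs : Ss' ≤ Ns' * l ^ s) (h4L : 4 / (L : ℝ) ≤ Xv)
    (hXv : Xv ≤ 1 / β ^ 3) :
    (L : ℝ) ^ 2 * (L : ℝ) ^ j * ((P * P * ((0 ! : ℝ)) ^ 2 * ρ₄ ^ 0 + 2 * (P * ((0 ! : ℝ)) ^ 2 * ρ₃ ^ 0)) * ((1 / 4 * Ss') / (1 + (L : ℝ) / 4) ^ s)) ≤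
      2 ^ 18 * Ns' * Xv ^ 4 := by
  have hLr : (4 : ℝ) ≤ L := by exact_mod_cast hL4
  have hLpos : (0 : ℝ) < L := by linarith
  have hq0 : 0 ≤ 4 / (L : ℝ) := by positivity
  have hl0 : 0 ≤ l := zero_le_one.trans hl1
  have hN' : 0 ≤ Ns' := (mul_nonneg_iff_of_pos_right (pow_pos (one_pos.trans_le hl1) s)).mp (hSs0.trans hSs)
  have hA : P * P * ((0 ! : ℝ)) ^ 2 * ρ₄ ^ 0 + 2 * (P * ((0 ! : ℝ)) ^ 2 * ρ₃ ^ 0) = P * P + 2 * P := by simp [Nat.factorial]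
  rw [hA]
  have hPP0 : 0 ≤ P * P + 2 * P := by positivity
  have hPP : P * P + 2 * P ≤ 168 := by nlinarith
  have hM0 : 0 ≤ 1 / 4 * Ss' := by positivity
  have h := far_weight_le hL4 hPP0 hM0 hj (show 6 ≤ s by omega)
  have habs : l ^ s * (4 / (L : ℝ)) ^ (s - 6) ≤ Xv ^ 4 := pow_absorb_lin hl0 hl hq0 h4L hXv hβ hs
  have hXv0 : 0 ≤ Xv ^ 4 := (mul_nonneg (pow_nonneg hl0 s) (pow_nonneg hq0 _)).trans habs
  have hkey : Ss' * (4 / (L : ℝ)) ^ (s - 6) ≤ Ns' * Xv ^ 4 := by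
    calc Ss' * (4 / (L : ℝ)) ^ (s - 6) ≤ (Ns' * l ^ s) * (4 / (L : ℝ)) ^ (s - 6) := mul_le_mul_of_nonneg_right hSs (pow_nonneg hq0 _)
      _ = Ns' * (l ^ s * (4 / (L : ℝ)) ^ (s - 6)) := by ring
      _ ≤ Ns' * Xv ^ 4 := mul_le_mul_of_nonneg_left habs hN'
  calc (L : ℝ) ^ 2 * (L : ℝ) ^ j * ((P * P + 2 * P) * ((1 / 4 * Ss') / (1 + (L : ℝ) / 4) ^ s))
      ≤ (P * P + 2 * P) * (1 / 4 * Ss') * 4 ^ 6 * (4 / (L : ℝ)) ^ (s - 6) := h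
    _ = (P * P + 2 * P) * 4 ^ 5 * (Ss' * (4 / (L : ℝ)) ^ (s - 6)) := by ring
    _ ≤ 168 * 4 ^ 5 * (Ns' * Xv ^ 4) :=
        mul_le_mul (mul_le_mul_of_nonneg_right hPP (by norm_num)) hkey (mul_nonneg hSs0 (pow_nonneg hq0 _)) (by positivity)
    _ ≤ 2 ^ 18 * Ns' * Xv ^ 4 := by nlinarith [mul_nonneg hN' hXv0]

end Summit.HubbardSuperconductivity.HubbardSuperconductivity.Theorems.EngineV8

end
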